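import Mathlib
import Literature.Analysis.FluidPDE.Tao2016AveragedNS.BoundedEternalSolutions
import Summits.NavierStokesRegularity.NavierStokesRegularity.Theses.TaoLadderRungTwoBreak
import Summits.NavierStokesRegularity.NavierStokesRegularity.Theorems.TaoLadderRungTwoBreakNoSurvivingEternalViscBddOneSurvivingPumps
import HarnessLib

/-!
# Crux K1ᵛ(1) `TaoLadderRungTwoBreak.NoSurvivingEternalViscBddOne` (stmt-NavierStokesRegularity-20419) and (ρ+) `NoLoudLadderOne`
# (stmt-NavierStokesRegularity-20452): NO SPREAD-UNIFORM THRESHOLD, and the threshold `εs(R)` is forced below every fine scale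
# (UNCONDITIONAL consequences of the surviving loud pumps of `…SurvivingPumps`)

MODEL lattice ODEs only (Tao 2016 §4, log-time variables §6.4); nothing in this file is a statement about the Navier–Stokes equations;
no stub, crux or summit is closed (`--supports stmt-NavierStokesRegularity-20419`).

From `survivingLoudPump_at_scale` (prequel): at EVERY `ε₀ > 0` with `(1+ε₀)^{5/2} ≤ 3/2` some comparable table carries a uniformly
bounded admissible viscous eternal solution (`ν̂ = 1`) that is forward (S₁)-surviving and loud on every shell.  Hence:

* `noSurvivingEternalViscBdd_inner_false_at_scale` / `noLoudLadder_inner_false_at_scale` — at every such `ε₀` the inner blocks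
  «∀ R ≥ 1, ∀ α ∈ E₂(R), ∀ ν̂, ∀ W bounded admissible (loud), ¬ (S₁)-surviving» of K1ᵛ(1) and of (ρ+) are FALSE;
* `not_uniform_noSurvivingEternalViscBdd` / `not_uniform_noLoudLadder` — **NO SPREAD-UNIFORM THRESHOLD**: the strengthenings
  `∃ εs > 0, ∀ R ≥ 1, ∀ ε₀ ∈ (0, εs], …` of `∀ R ≥ 1, NoSurvivingEternalViscBdd R 1` and of `∀ R ≥ 1, NoLoudLadder R` are FALSE
  (`exists_fine_scale_le`: `min εs (1/10)` is a fine scale);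
* `noSurvivingEternalViscBdd_threshold_lt` / `noLoudLadder_threshold_lt` — at every fine `ε₀` there is a spread `R ≥ 1` at which EVERY
  threshold `εs` witnessing the inner statement satisfies `εs < ε₀`;
* BY NAME: `threshold_lt_of_NoSurvivingEternalViscBddOne`, `loudThreshold_lt_of_NoLoudLadderOne` — if K1ᵛ(1) (resp. (ρ+)) holds, its
  threshold function is driven below every fine scale along the pump spreads: the cruxes ARE statements about `εs(R) → 0`, with no
  content uniform in the spread (kernel form of the rotor/Toda numerics `εs(R) ≈ 0.2 R^{-0.6}` recorded on ⟨25646⟩).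

* `eternalRigidityViscBdd_conclusion_on_pumpTable` — remark for K2ᵛ(1) ⟨20420⟩: the conclusion object of its (ω4) stub exists on the
  pump table at every fine scale (its inner block holds there for every datum).

HONEST LABEL: composition of landed theorems; ⟨20419⟩, ⟨20420⟩, (ρ0), (ρ+) and every NS statement remain OPEN; rung 0.
-/

noncomputable section

-- the summit and its single sub-problem share the name (CONVENTIONS §1)
set_option linter.dupNamespace false

namespace Summit.NavierStokesRegularity.NavierStokesRegularity.Theorems.NoSurvivingEternalViscBddOne.SurvivingPumps

open Set Filter Topology MeasureTheory
open Literature.Analysis.FluidPDE Literature.Analysis.FluidPDE.TaoCascade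
open Summit.NavierStokesRegularity.NavierStokesRegularity.Theses.TaoLadderRungTwoBreak
  (NoSurvivingEternalViscBddOne NoLoudLadderOne)

/-! ## Consequences for K1ᵛ(1) and (ρ+): inner blocks false at every fine scale, no spread-uniform threshold -/

/-- **The inner block of `NoSurvivingEternalViscBdd · 1` is FALSE at every fine scale** (`ε₀ > 0`, `(1+ε₀)^{5/2} ≤ 3/2`):
it is not the case that every uniformly bounded admissible viscous eternal solution of every comparable table at scale ratio
`1+ε₀` fails to be forward (S₁)-surviving.  MODEL lattice only.
[cite: Tao2016AveragedNS, §4 Thm. 4.2 (statement shape), the viscous equation before it, §6.4; cell vocabulary (stmt-NavierStokesRegularity-20419)] -/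
theorem noSurvivingEternalViscBdd_inner_false_at_scale (ε₀ : ℝ) (hε₀ : 0 < ε₀)
    (hε₀le : (1 + ε₀) ^ ((5 : ℝ) / 2) ≤ 3 / 2) :
    ¬ ∀ R : ℝ, 1 ≤ R → ∀ α : Fin 4 → Fin 4 → Fin 4 → ℤ × ℤ × ℤ → ℝ, InTableClass R α →
        ∀ (νh : ℝ) (W : ℤ → ℝ → Em 4), IsEternalVisc ε₀ νh α W → UniformBound W →
          ¬ EternalSurvivingFwd 1 ε₀ W := by
  intro h
  obtain ⟨R, hR, α, hα, W, hW, hU, hS, -, -, -⟩ := survivingLoudPump_at_scale ε₀ hε₀ hε₀le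
  exact h R hR α hα 1 W hW hU hS

/-- **The inner block of `NoLoudLadder ·` is FALSE at every fine scale**: the surviving pump is loud on every shell
(`ν̂ = 1`, level `1/4096`).  MODEL lattice only.
[cite: Tao2016AveragedNS, §4 Thm. 4.2 (statement shape), the viscous equation before it, §6.4; cell vocabulary (stmt-NavierStokesRegularity-20452)] -/
theorem noLoudLadder_inner_false_at_scale (ε₀ : ℝ) (hε₀ : 0 < ε₀)
    (hε₀le : (1 + ε₀) ^ ((5 : ℝ) / 2) ≤ 3 / 2) :
    ¬ ∀ R : ℝ, 1 ≤ R → ∀ α : Fin 4 → Fin 4 → Fin 4 → ℤ × ℤ × ℤ → ℝ, InTableClass R α →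
        ∀ (νh : ℝ) (W : ℤ → ℝ → Em 4), 0 < νh → IsEternalVisc ε₀ νh α W → UniformBound W →
          (∀ n₀ : ℕ, ∀ s₀ : ℝ, s₀ < νh ^ 2 / 4096 → ∃ σ : ℝ, s₀ < wtEnergy ε₀ W n₀ σ) →
            ¬ EternalSurvivingFwd 1 ε₀ W := by
  intro h
  obtain ⟨R, hR, α, hα, W, hW, hU, hS, -, -, hloud⟩ := survivingLoudPump_at_scale ε₀ hε₀ hε₀le
  exact h R hR α hα 1 W one_pos hW hU (fun n₀ s₀ hs₀ => hloud n₀ s₀ (by simpa using hs₀)) hS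

/-- A fine scale below any prescribed positive bound: `ε₀ = min εs (1/10)` has `(1+ε₀)^{5/2} ≤ (11/10)^3 ≤ 3/2`. [folklore] -/
theorem exists_fine_scale_le (εs : ℝ) (hεs : 0 < εs) :
    ∃ ε₀ : ℝ, 0 < ε₀ ∧ ε₀ ≤ εs ∧ (1 + ε₀) ^ ((5 : ℝ) / 2) ≤ 3 / 2 := by
  refine ⟨min εs (1 / 10), lt_min hεs (by norm_num), min_le_left _ _, ?_⟩
  have h0 : 0 < min εs (1 / 10) := lt_min hεs (by norm_num)
  have h2 : 1 + min εs (1 / 10) ≤ 11 / 10 := by have := min_le_right εs (1 / 10); linarith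
  calc (1 + min εs (1 / 10)) ^ ((5 : ℝ) / 2) ≤ (11 / 10 : ℝ) ^ ((5 : ℝ) / 2) :=
        Real.rpow_le_rpow (by linarith) h2 (by norm_num)
    _ ≤ (11 / 10 : ℝ) ^ ((3 : ℕ) : ℝ) :=
        Real.rpow_le_rpow_of_exponent_le (by norm_num) (by norm_num)
    _ = (11 / 10 : ℝ) ^ 3 := Real.rpow_natCast _ 3
    _ ≤ 3 / 2 := by norm_num

/-- **NO SPREAD-UNIFORM THRESHOLD for K1ᵛ(1).**  The strengthening `∃ εs > 0, ∀ R ≥ 1, ∀ ε₀ ∈ (0, εs], …` (threshold chosen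
before the spread) of `∀ R ≥ 1, NoSurvivingEternalViscBdd R 1` is FALSE.  MODEL lattice only; ⟨20419⟩ itself (threshold depending
on `R`) is neither proved nor refuted.
[cite: Tao2016AveragedNS, §4 Thm. 4.2 (statement shape), the viscous equation before it, §6.4; cell vocabulary (stmt-NavierStokesRegularity-20419)] -/
theorem not_uniform_noSurvivingEternalViscBdd :
    ¬ ∃ εs : ℝ, 0 < εs ∧ ∀ R : ℝ, 1 ≤ R → ∀ ε₀ : ℝ, 0 < ε₀ → ε₀ ≤ εs →
        ∀ α : Fin 4 → Fin 4 → Fin 4 → ℤ × ℤ × ℤ → ℝ, InTableClass R α →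
          ∀ (νh : ℝ) (W : ℤ → ℝ → Em 4), IsEternalVisc ε₀ νh α W → UniformBound W →
            ¬ EternalSurvivingFwd 1 ε₀ W := by
  rintro ⟨εs, hεs, h⟩
  obtain ⟨ε₀, hε₀, hle, hfine⟩ := exists_fine_scale_le εs hεs
  exact noSurvivingEternalViscBdd_inner_false_at_scale ε₀ hε₀ hfine
    (fun R hR α hα νh W hW hU => h R hR ε₀ hε₀ hle α hα νh W hW hU)

/-- **NO SPREAD-UNIFORM THRESHOLD for (ρ+) `NoLoudLadder`.**  MODEL lattice only; ⟨20452⟩ itself is neither proved nor refuted.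
[cite: Tao2016AveragedNS, §4 Thm. 4.2 (statement shape), the viscous equation before it, §6.4; cell vocabulary (stmt-NavierStokesRegularity-20452)] -/
theorem not_uniform_noLoudLadder :
    ¬ ∃ εs : ℝ, 0 < εs ∧ ∀ R : ℝ, 1 ≤ R → ∀ ε₀ : ℝ, 0 < ε₀ → ε₀ ≤ εs →
        ∀ α : Fin 4 → Fin 4 → Fin 4 → ℤ × ℤ × ℤ → ℝ, InTableClass R α →
          ∀ (νh : ℝ) (W : ℤ → ℝ → Em 4), 0 < νh → IsEternalVisc ε₀ νh α W → UniformBound W →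
            (∀ n₀ : ℕ, ∀ s₀ : ℝ, s₀ < νh ^ 2 / 4096 → ∃ σ : ℝ, s₀ < wtEnergy ε₀ W n₀ σ) →
              ¬ EternalSurvivingFwd 1 ε₀ W := by
  rintro ⟨εs, hεs, h⟩
  obtain ⟨ε₀, hε₀, hle, hfine⟩ := exists_fine_scale_le εs hεs
  exact noLoudLadder_inner_false_at_scale ε₀ hε₀ hfine
    (fun R hR α hα νh W hν hW hU hl => h R hR ε₀ hε₀ hle α hα νh W hν hW hU hl)

/-! ## The threshold function is forced below every fine scale (and the same BY NAME under the cruxes) -/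

/-- **Threshold of K1ᵛ(1) below every fine scale.**  For every fine `ε₀` there is a spread `R ≥ 1` (the pump's, `2/ε(ε₀)`)
at which EVERY threshold `εs` witnessing the inner statement of `NoSurvivingEternalViscBdd R 1` satisfies `εs < ε₀`.  MODEL lattice only.
[cite: Tao2016AveragedNS, §4 Thm. 4.2 (statement shape), the viscous equation before it, §6.4; cell vocabulary (stmt-NavierStokesRegularity-20419)] -/
theorem noSurvivingEternalViscBdd_threshold_lt (ε₀ : ℝ) (hε₀ : 0 < ε₀)
    (hε₀le : (1 + ε₀) ^ ((5 : ℝ) / 2) ≤ 3 / 2) :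
    ∃ R : ℝ, 1 ≤ R ∧ ∀ εs : ℝ,
      (∀ ε : ℝ, 0 < ε → ε ≤ εs → ∀ α : Fin 4 → Fin 4 → Fin 4 → ℤ × ℤ × ℤ → ℝ, InTableClass R α →
        ∀ (νh : ℝ) (W : ℤ → ℝ → Em 4), IsEternalVisc ε νh α W → UniformBound W →
          ¬ EternalSurvivingFwd 1 ε W) → εs < ε₀ := by
  obtain ⟨R, hR, α, hα, W, hW, hU, hS, -, -, -⟩ := survivingLoudPump_at_scale ε₀ hε₀ hε₀le
  refine ⟨R, hR, fun εs h => ?_⟩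
  by_contra hge
  push Not at hge
  exact h ε₀ hε₀ hge α hα 1 W hW hU hS

/-- **Threshold of (ρ+) below every fine scale.**  MODEL lattice only.
[cite: Tao2016AveragedNS, §4 Thm. 4.2 (statement shape), the viscous equation before it, §6.4; cell vocabulary (stmt-NavierStokesRegularity-20452)] -/
theorem noLoudLadder_threshold_lt (ε₀ : ℝ) (hε₀ : 0 < ε₀)
    (hε₀le : (1 + ε₀) ^ ((5 : ℝ) / 2) ≤ 3 / 2) :
    ∃ R : ℝ, 1 ≤ R ∧ ∀ εs : ℝ,
      (∀ ε : ℝ, 0 < ε → ε ≤ εs → ∀ α : Fin 4 → Fin 4 → Fin 4 → ℤ × ℤ × ℤ → ℝ, InTableClass R α →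
        ∀ (νh : ℝ) (W : ℤ → ℝ → Em 4), 0 < νh → IsEternalVisc ε νh α W → UniformBound W →
          (∀ n₀ : ℕ, ∀ s₀ : ℝ, s₀ < νh ^ 2 / 4096 → ∃ σ : ℝ, s₀ < wtEnergy ε W n₀ σ) →
            ¬ EternalSurvivingFwd 1 ε W) → εs < ε₀ := by
  obtain ⟨R, hR, α, hα, W, hW, hU, hS, -, -, hloud⟩ := survivingLoudPump_at_scale ε₀ hε₀ hε₀le
  refine ⟨R, hR, fun εs h => ?_⟩
  by_contra hge
  push Not at hge
  exact h ε₀ hε₀ hge α hα 1 W one_pos hW hU (fun n₀ s₀ hs₀ => hloud n₀ s₀ (by simpa using hs₀)) hS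

/-- **BY NAME: under K1ᵛ(1) `NoSurvivingEternalViscBddOne` (stmt-NavierStokesRegularity-20419) the threshold function tends below
every fine scale along the pump spreads** — for every fine `ε₀` some spread `R ≥ 1` has its (crux-given) threshold `εs ∈ (0, ε₀)`.
So the crux is exactly a statement about `εs(R) → 0`; it has no content uniform in the spread.  MODEL lattice only; ⟨20419⟩ stays OPEN.
[cite: Tao2016AveragedNS, §4 Thm. 4.2 (statement shape), the viscous equation before it, §6.4; cell vocabulary (stmt-NavierStokesRegularity-20419)] -/
theorem threshold_lt_of_NoSurvivingEternalViscBddOne (hK : NoSurvivingEternalViscBddOne)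
    (ε₀ : ℝ) (hε₀ : 0 < ε₀) (hε₀le : (1 + ε₀) ^ ((5 : ℝ) / 2) ≤ 3 / 2) :
    ∃ R : ℝ, 1 ≤ R ∧ ∃ εs : ℝ, 0 < εs ∧ εs < ε₀ ∧
      ∀ ε : ℝ, 0 < ε → ε ≤ εs → ∀ α : Fin 4 → Fin 4 → Fin 4 → ℤ × ℤ × ℤ → ℝ, InTableClass R α →
        ∀ (νh : ℝ) (W : ℤ → ℝ → Em 4), IsEternalVisc ε νh α W → UniformBound W →
          ¬ EternalSurvivingFwd 1 ε W := by
  obtain ⟨R, hR, hlt⟩ := noSurvivingEternalViscBdd_threshold_lt ε₀ hε₀ hε₀le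
  obtain ⟨εs, hεs, H⟩ := hK R hR
  exact ⟨R, hR, εs, hεs, hlt εs H, H⟩

/-- **BY NAME: under (ρ+) `NoLoudLadderOne` (stmt-NavierStokesRegularity-20452) the loud-ladder threshold tends below every fine scale
along the pump spreads.**  MODEL lattice only; ⟨20452⟩ stays OPEN.
[cite: Tao2016AveragedNS, §4 Thm. 4.2 (statement shape), the viscous equation before it, §6.4; cell vocabulary (stmt-NavierStokesRegularity-20452)] -/
theorem loudThreshold_lt_of_NoLoudLadderOne (hL : NoLoudLadderOne)
    (ε₀ : ℝ) (hε₀ : 0 < ε₀) (hε₀le : (1 + ε₀) ^ ((5 : ℝ) / 2) ≤ 3 / 2) :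
    ∃ R : ℝ, 1 ≤ R ∧ ∃ εs : ℝ, 0 < εs ∧ εs < ε₀ ∧
      ∀ ε : ℝ, 0 < ε → ε ≤ εs → ∀ α : Fin 4 → Fin 4 → Fin 4 → ℤ × ℤ × ℤ → ℝ, InTableClass R α →
        ∀ (νh : ℝ) (W : ℤ → ℝ → Em 4), 0 < νh → IsEternalVisc ε νh α W → UniformBound W →
          (∀ n₀ : ℕ, ∀ s₀ : ℝ, s₀ < νh ^ 2 / 4096 → ∃ σ : ℝ, s₀ < wtEnergy ε W n₀ σ) →
            ¬ EternalSurvivingFwd 1 ε W := by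
  obtain ⟨R, hR, hlt⟩ := noLoudLadder_threshold_lt ε₀ hε₀ hε₀le
  obtain ⟨εs, hεs, H⟩ := hL R hR
  exact ⟨R, hR, εs, hεs, hlt εs H, H⟩

/-! ## Remark for K2ᵛ(1) `EternalRigidityViscBddOne` (stmt-NavierStokesRegularity-20420): its conclusion class is realised on the pump tables -/

/-- **The conclusion of K2ᵛ(1) is realised at every fine scale on the pump table** — whatever the datum `X₀` and whether or not it
blows up robustly, the object `∃ ν̂ W, IsEternalVisc ε₀ ν̂ α W ∧ UniformBound W ∧ EternalSurvivingFwd 1 ε₀ W` that the (ω4) stub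
`stub_eternalLimitViscBdd` of ⟨20420⟩ must extract EXISTS on the padded seeded Toda member at scale ratio `1+ε₀` (first exhibited
member of that conclusion class; the inner block of `EternalRigidityViscBdd R 1` holds there trivially).  MODEL lattice only;
⟨20420⟩ stays OPEN.
[cite: Tao2016AveragedNS, §4 Thm. 4.2 (statement shape), the viscous equation before it, §6.4; cell vocabulary (stmt-NavierStokesRegularity-20420)] -/
theorem eternalRigidityViscBdd_conclusion_on_pumpTable (ε₀ : ℝ) (hε₀ : 0 < ε₀)
    (hε₀le : (1 + ε₀) ^ ((5 : ℝ) / 2) ≤ 3 / 2) :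
    ∃ R : ℝ, 1 ≤ R ∧ ∃ α : Fin 4 → Fin 4 → Fin 4 → ℤ × ℤ × ℤ → ℝ, InTableClass R α ∧
      ∀ X₀ : Fin 4 → ℝ, NoGlobalCascade ε₀ α X₀ →
        ∃ (νh : ℝ) (W : ℤ → ℝ → Em 4), IsEternalVisc ε₀ νh α W ∧ UniformBound W ∧ EternalSurvivingFwd 1 ε₀ W := by
  obtain ⟨R, hR, α, hα, W, hW, hU, hS, -, -, -⟩ := survivingLoudPump_at_scale ε₀ hε₀ hε₀le
  exact ⟨R, hR, α, hα, fun _ _ => ⟨1, W, hW, hU, hS⟩⟩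

/-! ## Appended (same hand): ALL LARGE SPREADS — every admissible threshold FUNCTION tends to zero

The class `E₂(R)` grows with `R` (`InTableClass.mono`), so the pump table of scale ratio `1+ε₀` lies in `E₂(R)` for every
`R ≥ 2/ε(ε₀)`: the threshold is below `ε₀` at ALL large spreads, not only along a sequence.  Packaged as a limit: ANY selection
`R ↦ εs(R)` of positive thresholds witnessing the inner statement of K1ᵛ(1) (resp. (ρ+)) at every spread `R ≥ 1` satisfies
`εs(R) → 0` as `R → ∞`; under the crux such a selection exists.  MODEL lattice only; nothing about the Navier–Stokes equations. -/

/-- **Surviving loud pumps at a fine scale on EVERY larger spread.**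
[cite: Tao2016AveragedNS, §4 Thm. 4.2 (statement shape), the viscous equation before it, §6.1, §6.4; cell vocabulary (stmt-NavierStokesRegularity-20419)] -/
theorem survivingLoudPump_at_scale_eventually (ε₀ : ℝ) (hε₀ : 0 < ε₀)
    (hε₀le : (1 + ε₀) ^ ((5 : ℝ) / 2) ≤ 3 / 2) :
    ∃ R₀ : ℝ, 1 ≤ R₀ ∧ ∀ R : ℝ, R₀ ≤ R → ∃ α : Fin 4 → Fin 4 → Fin 4 → ℤ × ℤ × ℤ → ℝ, InTableClass R α ∧
      ∃ W : ℤ → ℝ → Em 4, IsEternalVisc ε₀ 1 α W ∧ UniformBound W ∧ EternalSurvivingFwd 1 ε₀ W ∧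
        (∀ (n₀ : ℕ) (s₀ : ℝ), s₀ < 1 / 4096 → ∃ σ : ℝ, s₀ < wtEnergy ε₀ W n₀ σ) := by
  obtain ⟨R₀, hR₀, α, hα, W, hW, hU, hS, -, -, hloud⟩ := survivingLoudPump_at_scale ε₀ hε₀ hε₀le
  exact ⟨R₀, hR₀, fun R hR => ⟨α, hα.mono (by linarith) hR, W, hW, hU, hS, hloud⟩⟩

/-- **Threshold of K1ᵛ(1) below `ε₀` at ALL spreads `R ≥ R₀(ε₀)`.**
[cite: Tao2016AveragedNS, §4 Thm. 4.2 (statement shape), the viscous equation before it, §6.1, §6.4; cell vocabulary (stmt-NavierStokesRegularity-20419)] -/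
theorem noSurvivingEternalViscBdd_threshold_lt_eventually (ε₀ : ℝ) (hε₀ : 0 < ε₀)
    (hε₀le : (1 + ε₀) ^ ((5 : ℝ) / 2) ≤ 3 / 2) :
    ∃ R₀ : ℝ, 1 ≤ R₀ ∧ ∀ R : ℝ, R₀ ≤ R → ∀ εs : ℝ,
      (∀ ε : ℝ, 0 < ε → ε ≤ εs → ∀ α : Fin 4 → Fin 4 → Fin 4 → ℤ × ℤ × ℤ → ℝ, InTableClass R α →
        ∀ (νh : ℝ) (W : ℤ → ℝ → Em 4), IsEternalVisc ε νh α W → UniformBound W →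
          ¬ EternalSurvivingFwd 1 ε W) → εs < ε₀ := by
  obtain ⟨R₀, hR₀, H⟩ := survivingLoudPump_at_scale_eventually ε₀ hε₀ hε₀le
  refine ⟨R₀, hR₀, fun R hR εs h => ?_⟩
  obtain ⟨α, hα, W, hW, hU, hS, -⟩ := H R hR
  by_contra hge
  push Not at hge
  exact h ε₀ hε₀ hge α hα 1 W hW hU hS

/-- **Threshold of (ρ+) below `ε₀` at ALL spreads `R ≥ R₀(ε₀)`.**
[cite: Tao2016AveragedNS, §4 Thm. 4.2 (statement shape), the viscous equation before it, §6.1, §6.4; cell vocabulary (stmt-NavierStokesRegularity-20452)] -/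
theorem noLoudLadder_threshold_lt_eventually (ε₀ : ℝ) (hε₀ : 0 < ε₀)
    (hε₀le : (1 + ε₀) ^ ((5 : ℝ) / 2) ≤ 3 / 2) :
    ∃ R₀ : ℝ, 1 ≤ R₀ ∧ ∀ R : ℝ, R₀ ≤ R → ∀ εs : ℝ,
      (∀ ε : ℝ, 0 < ε → ε ≤ εs → ∀ α : Fin 4 → Fin 4 → Fin 4 → ℤ × ℤ × ℤ → ℝ, InTableClass R α →
        ∀ (νh : ℝ) (W : ℤ → ℝ → Em 4), 0 < νh → IsEternalVisc ε νh α W → UniformBound W →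
          (∀ n₀ : ℕ, ∀ s₀ : ℝ, s₀ < νh ^ 2 / 4096 → ∃ σ : ℝ, s₀ < wtEnergy ε W n₀ σ) →
            ¬ EternalSurvivingFwd 1 ε W) → εs < ε₀ := by
  obtain ⟨R₀, hR₀, H⟩ := survivingLoudPump_at_scale_eventually ε₀ hε₀ hε₀le
  refine ⟨R₀, hR₀, fun R hR εs h => ?_⟩
  obtain ⟨α, hα, W, hW, hU, hS, hloud⟩ := H R hR
  by_contra hge
  push Not at hge
  exact h ε₀ hε₀ hge α hα 1 W one_pos hW hU (fun n₀ s₀ hs₀ => hloud n₀ s₀ (by simpa using hs₀)) hS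

/-- **Every admissible threshold selection of K1ᵛ(1) tends to zero.**  If `εs : ℝ → ℝ` assigns to each spread `R ≥ 1` a positive
threshold below which the inner statement of `NoSurvivingEternalViscBdd R 1` holds, then `εs R → 0` as `R → ∞`.
[cite: Tao2016AveragedNS, §4 Thm. 4.2 (statement shape), the viscous equation before it, §6.1, §6.4; cell vocabulary (stmt-NavierStokesRegularity-20419)] -/
theorem thresholdFun_tendsto_zero (εs : ℝ → ℝ) (hpos : ∀ R : ℝ, 1 ≤ R → 0 < εs R)
    (hwit : ∀ R : ℝ, 1 ≤ R → ∀ ε : ℝ, 0 < ε → ε ≤ εs R →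
      ∀ α : Fin 4 → Fin 4 → Fin 4 → ℤ × ℤ × ℤ → ℝ, InTableClass R α →
        ∀ (νh : ℝ) (W : ℤ → ℝ → Em 4), IsEternalVisc ε νh α W → UniformBound W → ¬ EternalSurvivingFwd 1 ε W) :
    Tendsto εs atTop (𝓝 0) := by
  rw [Metric.tendsto_atTop]
  intro δ hδ
  obtain ⟨ε₀, hε₀, hle, hfine⟩ := exists_fine_scale_le δ hδ
  obtain ⟨R₀, hR₀, H⟩ := noSurvivingEternalViscBdd_threshold_lt_eventually ε₀ hε₀ hfine
  refine ⟨R₀, fun R hR => ?_⟩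
  have h1 : εs R < ε₀ := H R hR (εs R) (hwit R (hR₀.trans hR))
  have h2 : 0 < εs R := hpos R (hR₀.trans hR)
  rw [Real.dist_eq, sub_zero, abs_of_pos h2]
  linarith

/-- **Every admissible threshold selection of (ρ+) tends to zero.**
[cite: Tao2016AveragedNS, §4 Thm. 4.2 (statement shape), the viscous equation before it, §6.1, §6.4; cell vocabulary (stmt-NavierStokesRegularity-20452)] -/
theorem loudThresholdFun_tendsto_zero (εs : ℝ → ℝ) (hpos : ∀ R : ℝ, 1 ≤ R → 0 < εs R)
    (hwit : ∀ R : ℝ, 1 ≤ R → ∀ ε : ℝ, 0 < ε → ε ≤ εs R →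
      ∀ α : Fin 4 → Fin 4 → Fin 4 → ℤ × ℤ × ℤ → ℝ, InTableClass R α →
        ∀ (νh : ℝ) (W : ℤ → ℝ → Em 4), 0 < νh → IsEternalVisc ε νh α W → UniformBound W →
          (∀ n₀ : ℕ, ∀ s₀ : ℝ, s₀ < νh ^ 2 / 4096 → ∃ σ : ℝ, s₀ < wtEnergy ε W n₀ σ) →
            ¬ EternalSurvivingFwd 1 ε W) :
    Tendsto εs atTop (𝓝 0) := by
  rw [Metric.tendsto_atTop]
  intro δ hδ
  obtain ⟨ε₀, hε₀, hle, hfine⟩ := exists_fine_scale_le δ hδ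
  obtain ⟨R₀, hR₀, H⟩ := noLoudLadder_threshold_lt_eventually ε₀ hε₀ hfine
  refine ⟨R₀, fun R hR => ?_⟩
  have h1 : εs R < ε₀ := H R hR (εs R) (hwit R (hR₀.trans hR))
  have h2 : 0 < εs R := hpos R (hR₀.trans hR)
  rw [Real.dist_eq, sub_zero, abs_of_pos h2]
  linarith

/-- **BY NAME: K1ᵛ(1) `NoSurvivingEternalViscBddOne` (stmt-NavierStokesRegularity-20419) ⟹ a threshold selection EXISTS and EVERY one
tends to zero** — the crux is precisely the statement «the viscous bounded Liouville threshold `εs(R)` exists for each spread», and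
then necessarily `εs(R) → 0`: no part of it is uniform in the spread.  MODEL lattice only; ⟨20419⟩ stays OPEN.
[cite: Tao2016AveragedNS, §4 Thm. 4.2 (statement shape), the viscous equation before it, §6.1, §6.4; cell vocabulary (stmt-NavierStokesRegularity-20419)] -/
theorem exists_thresholdFun_tendsto_zero_of_NoSurvivingEternalViscBddOne (hK : NoSurvivingEternalViscBddOne) :
    ∃ εs : ℝ → ℝ, (∀ R : ℝ, 1 ≤ R → 0 < εs R ∧ ∀ ε : ℝ, 0 < ε → ε ≤ εs R →
        ∀ α : Fin 4 → Fin 4 → Fin 4 → ℤ × ℤ × ℤ → ℝ, InTableClass R α →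
          ∀ (νh : ℝ) (W : ℤ → ℝ → Em 4), IsEternalVisc ε νh α W → UniformBound W → ¬ EternalSurvivingFwd 1 ε W) ∧
      Tendsto εs atTop (𝓝 0) := by
  classical
  have hch : ∀ R : ℝ, 1 ≤ R → ∃ e : ℝ, 0 < e ∧ ∀ ε : ℝ, 0 < ε → ε ≤ e →
      ∀ α : Fin 4 → Fin 4 → Fin 4 → ℤ × ℤ × ℤ → ℝ, InTableClass R α →
        ∀ (νh : ℝ) (W : ℤ → ℝ → Em 4), IsEternalVisc ε νh α W → UniformBound W → ¬ EternalSurvivingFwd 1 ε W :=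
    fun R hR => hK R hR
  refine ⟨fun R => if h : 1 ≤ R then Classical.choose (hch R h) else 1, ?_, ?_⟩
  · intro R hR
    simp only [dif_pos hR]
    exact Classical.choose_spec (hch R hR)
  · refine thresholdFun_tendsto_zero _ (fun R hR => ?_) (fun R hR => ?_)
    · simp only [dif_pos hR]; exact (Classical.choose_spec (hch R hR)).1
    · simp only [dif_pos hR]; exact (Classical.choose_spec (hch R hR)).2

/-- **BY NAME: (ρ+) `NoLoudLadderOne` (stmt-NavierStokesRegularity-20452) ⟹ a loud-ladder threshold selection EXISTS and EVERY one tends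
to zero.**  MODEL lattice only; ⟨20452⟩ stays OPEN.
[cite: Tao2016AveragedNS, §4 Thm. 4.2 (statement shape), the viscous equation before it, §6.1, §6.4; cell vocabulary (stmt-NavierStokesRegularity-20452)] -/
theorem exists_loudThresholdFun_tendsto_zero_of_NoLoudLadderOne (hL : NoLoudLadderOne) :
    ∃ εs : ℝ → ℝ, (∀ R : ℝ, 1 ≤ R → 0 < εs R ∧ ∀ ε : ℝ, 0 < ε → ε ≤ εs R →
        ∀ α : Fin 4 → Fin 4 → Fin 4 → ℤ × ℤ × ℤ → ℝ, InTableClass R α →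
          ∀ (νh : ℝ) (W : ℤ → ℝ → Em 4), 0 < νh → IsEternalVisc ε νh α W → UniformBound W →
            (∀ n₀ : ℕ, ∀ s₀ : ℝ, s₀ < νh ^ 2 / 4096 → ∃ σ : ℝ, s₀ < wtEnergy ε W n₀ σ) →
              ¬ EternalSurvivingFwd 1 ε W) ∧
      Tendsto εs atTop (𝓝 0) := by
  classical
  have hch : ∀ R : ℝ, 1 ≤ R → ∃ e : ℝ, 0 < e ∧ ∀ ε : ℝ, 0 < ε → ε ≤ e →
      ∀ α : Fin 4 → Fin 4 → Fin 4 → ℤ × ℤ × ℤ → ℝ, InTableClass R α →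
        ∀ (νh : ℝ) (W : ℤ → ℝ → Em 4), 0 < νh → IsEternalVisc ε νh α W → UniformBound W →
          (∀ n₀ : ℕ, ∀ s₀ : ℝ, s₀ < νh ^ 2 / 4096 → ∃ σ : ℝ, s₀ < wtEnergy ε W n₀ σ) →
            ¬ EternalSurvivingFwd 1 ε W :=
    fun R hR => hL R hR
  refine ⟨fun R => if h : 1 ≤ R then Classical.choose (hch R h) else 1, ?_, ?_⟩
  · intro R hR
    simp only [dif_pos hR]
    exact Classical.choose_spec (hch R hR)
  · refine loudThresholdFun_tendsto_zero _ (fun R hR => ?_) (fun R hR => ?_)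
    · simp only [dif_pos hR]; exact (Classical.choose_spec (hch R hR)).1
    · simp only [dif_pos hR]; exact (Classical.choose_spec (hch R hR)).2

end Summit.NavierStokesRegularity.NavierStokesRegularity.Theorems.NoSurvivingEternalViscBddOne.SurvivingPumps

end
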